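import Summits.MatrixMultiplication.OmegaCensus.Dicyclic40Law
import HarnessLib

/-!
# `β(C₂² × Q_{4m}) = 2β(C₂ × Q_{4m})` for every `m ≥ 3` with `m ≢ 4 (mod 6)`

ω-census, family (b3).  Framing: lottery ticket; floor = certified bounds/negative ranges.

`C₂² × Q_{4m} = G(ℤ₂ × (ℤ₂ × ℤ_{2m}), (0,(0,m)))` (`c2_product_presentation` on top of `c2_quaternion_presentation`),
`|A| = 8m`, and the quotient `A/⟨c₀⟩ ⊇ ℤ₂ × ℤ₂` is NEVER cyclic (`z2_z2_z2m_quot_noncyclic`).  Hence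
* `3 ∣ m`: the general law `V ≤ 64m/3`;
* `m ≡ 1 (mod 6)`: `|A| ≡ 2 (mod 3)`, dicyclic law `V ≤ (64m − 16)/3`;
* `m ≡ 2 (mod 3)`: `|A| ≡ 1 (mod 3)`, the law needs a cyclic quotient, `law − 4` is the P3 exclusion
  (`tpp_volume_dicyclic_quot_noncyclic_le`, `|A| ≥ 52`; `m = 5`: `tpp_volume_dicyclic_40_le`) ⇒ `V ≤ (64m − 32)/3 = 32⌊2m/3⌋`;
all attained by `(C₂, 1, 1) ×` an optimal triple of `C₂ × Q_{4m}`: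
**`c2c2_quaternion_law`: β(C₂² × Q_{4m}) = (64m − 16)/3 if m ≡ 1 (mod 6), else 32⌊2m/3⌋ (m ≥ 3, m ≢ 4 (mod 6))** — e.g.
`β(C₂² × Q₁₂) = 64`, `β(C₂² × Q₂₀) = 96`, `β(C₂² × Q₂₄) = 128`, `β(C₂² × Q₂₈) = 144`, `β(C₂² × Q₃₂) = 160`.
(`m ≡ 4 (mod 6)`: window `[(64m − 64)/3, (64m − 16)/3]`, open.)
-/

namespace Summit.MatrixMultiplication.OmegaCensus

open Literature.Combinatorics.Additive Finset
open Summit.MatrixMultiplication.MatrixMultiplication.Theorems.JuntaBranch.Planting (tpp_product)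

section C2C2Q

variable {m : ℕ} [NeZero m]

/-- `A/⟨c₀⟩` is not cyclic for `A = ℤ₂ × (ℤ₂ × ℤ_{2m})`, `c₀ = (0,(0,m))` (project to `ℤ₂ × ℤ₂`). [folklore] -/
theorem z2_z2_z2m_quot_noncyclic [NeZero (2 * m)] :
    (((0 : ZMod 2), (((0 : ZMod 2), (m : ZMod (2 * m))))) : ZMod 2 × (ZMod 2 × ZMod (2 * m))) ≠ 0 ∧
    ¬ ∃ g : ZMod 2 × (ZMod 2 × ZMod (2 * m)), ∀ x, x ∈ AddSubgroup.zmultiples g ∨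
      x + ((0 : ZMod 2), (((0 : ZMod 2), (m : ZMod (2 * m))))) ∈ AddSubgroup.zmultiples g := by
  have hm0 : m ≠ 0 := NeZero.ne m
  refine ⟨fun h0 => ?_, ?_⟩
  · have h1 : (m : ZMod (2 * m)) = 0 := congrArg (fun p : ZMod 2 × (ZMod 2 × ZMod (2 * m)) => p.2.2) h0
    rw [ZMod.natCast_eq_zero_iff] at h1
    have := Nat.le_of_dvd (Nat.pos_of_ne_zero hm0) h1
    omega
  · rintro ⟨g, hg⟩
    apply not_cyclic_zmod_two_prod (k := 2) (dvd_refl 2)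
    refine ⟨(g.1, g.2.1), fun y => ?_⟩
    have key : ∀ e : ZMod (2 * m), ((y.1, (y.2, e)) : ZMod 2 × (ZMod 2 × ZMod (2 * m))) ∈ AddSubgroup.zmultiples g →
        y ∈ AddSubgroup.zmultiples (g.1, g.2.1) := by
      intro e he
      obtain ⟨k, hk⟩ := AddSubgroup.mem_zmultiples_iff.1 he
      refine AddSubgroup.mem_zmultiples_iff.2 ⟨k, ?_⟩
      have h1 := congrArg Prod.fst hk
      have h2 := congrArg (fun p : ZMod 2 × (ZMod 2 × ZMod (2 * m)) => p.2.1) hk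
      simp only [Prod.smul_fst, Prod.smul_snd] at h1 h2
      exact Prod.ext h1 h2
    rcases hg (y.1, (y.2, 0)) with h | h
    · exact key 0 h
    · refine key (m : ZMod (2 * m)) ?_
      have e : ((y.1, (y.2, (0 : ZMod (2 * m)))) : ZMod 2 × (ZMod 2 × ZMod (2 * m))) + (0, (0, (m : ZMod (2 * m)))) =
          (y.1, (y.2, (m : ZMod (2 * m)))) :=
        Prod.ext (add_zero _) (Prod.ext (add_zero _) (zero_add _))
      rw [e] at h; exact h

/-- **Upper bound** for `C₂² × Q_{4m}`, `m ≥ 3`, `m ≢ 4 (mod 6)`. [folklore] -/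
theorem c2c2_quaternion_tpp_volume_le (hm : 3 ≤ m) (h4 : m % 6 ≠ 4)
    {S T U : Finset (Multiplicative (ZMod 2) × (Multiplicative (ZMod 2) × QuaternionGroup m))}
    (h : TripleProductProperty S T U) :
    S.card * T.card * U.card ≤ if m % 6 = 1 then (64 * m - 16) / 3 else 32 * (2 * m / 3) := by
  haveI : NeZero (2 * m) := ⟨by omega⟩
  obtain ⟨hc₀', hnq⟩ := z2_z2_z2m_quot_noncyclic (m := m)
  refine c2_quaternion_presentation (m := m) fun ρ τ c₀ hρρ hρτ hτρ hττ hρ hτ hne hsurj hc => ?_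
  subst hc
  refine c2_product_presentation hρρ hρτ hτρ hττ hρ hτ hne hsurj
    fun ρ' τ' c₀' hρρ' hρτ' hτρ' hττ' hρ' hτ' hne' hsurj' hc' => ?_
  subst hc'
  have hcard : Fintype.card (ZMod 2 × (ZMod 2 × ZMod (2 * m))) = 8 * m := by
    rw [Fintype.card_prod, Fintype.card_prod, ZMod.card, ZMod.card]; ring
  have h2c := two_c0_eq_zero hρτ' hτρ' hττ' hτ'
  by_cases h1 : m % 6 = 1
  · simp only [if_pos h1]
    have key := tpp_volume_le_law_dicyclicLike hρρ' hρτ' hτρ' hττ' hρ' hτ' hne' hsurj' h2c hc₀' (by rw [hcard]; omega)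
      (by rw [hcard]; omega) h
    rw [hcard] at key
    omega
  simp only [if_neg h1]
  by_cases h2 : m % 3 = 2
  · by_cases h5 : m = 5
    · subst h5
      have key := tpp_volume_dicyclic_40_le hρρ' hρτ' hτρ' hττ' hc₀' hnq hρ' hτ' hne' hsurj' (by rw [hcard]) h
      omega
    · have key := tpp_volume_dicyclic_quot_noncyclic_le hρρ' hρτ' hτρ' hττ' hc₀' hnq hρ' hτ' hne' hsurj'
        (by rw [hcard]; omega) (by rw [hcard]; omega) h
      rw [hcard] at key
      omega
  · have h0 : m % 3 = 0 := by omega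
    have key := tpp_volume_le_of_dihedralLike hρρ' hρτ' hτρ' hττ' hρ' hτ' hne' hsurj' h
    rw [hcard] at key
    omega

/-- **Lower bound**: `(C₂, 1, 1) ×` an optimal triple of `C₂ × Q_{4m}`. [folklore] -/
theorem c2c2_quaternion_volume_ge (hm : 3 ≤ m) :
    ∃ S T U : Finset (Multiplicative (ZMod 2) × (Multiplicative (ZMod 2) × QuaternionGroup m)),
      TripleProductProperty S T U ∧
      S.card * T.card * U.card = if m % 6 = 1 then (64 * m - 16) / 3 else 32 * (2 * m / 3) := by
  by_cases h1 : m % 6 = 1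
  · simp only [if_pos h1]
    obtain ⟨-, S, T, U, h, hvol⟩ := c2_quaternion_law_mod_six_one (m := m) h1 (by omega)
    refine ⟨univ ×ˢ S, {1} ×ˢ T, {1} ×ˢ U, tpp_product tpp_univ_one_one h, ?_⟩
    rw [card_product, card_product, card_product, card_univ, card_singleton, Fintype.card_multiplicative, ZMod.card]
    have e : 2 * S.card * (1 * T.card) * (1 * U.card) = 2 * (S.card * T.card * U.card) := by ring
    rw [e]; omega
  · simp only [if_neg h1]
    obtain ⟨S, T, U, h, hvol⟩ := c2_quaternion_volume_ge (m := m) hm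
    refine ⟨univ ×ˢ S, {1} ×ˢ T, {1} ×ˢ U, tpp_product tpp_univ_one_one h, ?_⟩
    rw [card_product, card_product, card_product, card_univ, card_singleton, Fintype.card_multiplicative, ZMod.card]
    have e : 2 * S.card * (1 * T.card) * (1 * U.card) = 2 * (S.card * T.card * U.card) := by ring
    rw [e, hvol]; ring

/-- **`β(C₂² × Q_{4m}) = 2β(C₂ × Q_{4m})` for every `m ≥ 3`, `m ≢ 4 (mod 6)`** (kernel): `(64m − 16)/3` if
`m ≡ 1 (mod 6)`, else `32⌊2m/3⌋`. [folklore] -/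
theorem c2c2_quaternion_law (hm : 3 ≤ m) (h4 : m % 6 ≠ 4) :
    (∀ S T U : Finset (Multiplicative (ZMod 2) × (Multiplicative (ZMod 2) × QuaternionGroup m)),
        TripleProductProperty S T U →
        S.card * T.card * U.card ≤ if m % 6 = 1 then (64 * m - 16) / 3 else 32 * (2 * m / 3)) ∧
    ∃ S T U : Finset (Multiplicative (ZMod 2) × (Multiplicative (ZMod 2) × QuaternionGroup m)),
      TripleProductProperty S T U ∧
      S.card * T.card * U.card = if m % 6 = 1 then (64 * m - 16) / 3 else 32 * (2 * m / 3) :=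
  ⟨fun _ _ _ h => c2c2_quaternion_tpp_volume_le hm h4 h, c2c2_quaternion_volume_ge hm⟩

/-- The order-80 instance: **`β(C₂² × Q₂₀) = 96`**. [folklore] -/
theorem c2c2_quaternion_20_law :
    (∀ S T U : Finset (Multiplicative (ZMod 2) × (Multiplicative (ZMod 2) × QuaternionGroup 5)),
        TripleProductProperty S T U → S.card * T.card * U.card ≤ 96) ∧
    ∃ S T U : Finset (Multiplicative (ZMod 2) × (Multiplicative (ZMod 2) × QuaternionGroup 5)),
      TripleProductProperty S T U ∧ S.card * T.card * U.card = 96 := by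
  obtain ⟨hub, S, T, U, h, hV⟩ := c2c2_quaternion_law (m := 5) (by norm_num) (by norm_num)
  exact ⟨fun S' T' U' h' => by have := hub S' T' U' h'; norm_num at this; exact this, S, T, U, h,
    by norm_num at hV; exact hV⟩

/-- The remaining case `m ≡ 4 (mod 6)`: window `(64m − 64)/3 ≤ β(C₂² × Q_{4m}) ≤ (64m − 16)/3` (dicyclic law vs
product construction). [folklore] -/
theorem c2c2_quaternion_window_mod_six_four (h4 : m % 6 = 4) :
    (∀ S T U : Finset (Multiplicative (ZMod 2) × (Multiplicative (ZMod 2) × QuaternionGroup m)),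
        TripleProductProperty S T U → 3 * (S.card * T.card * U.card) + 16 ≤ 64 * m) ∧
    ∃ S T U : Finset (Multiplicative (ZMod 2) × (Multiplicative (ZMod 2) × QuaternionGroup m)),
      TripleProductProperty S T U ∧ 3 * (S.card * T.card * U.card) + 64 = 64 * m := by
  haveI : NeZero (2 * m) := ⟨by omega⟩
  refine ⟨fun S T U h => ?_, ?_⟩
  · obtain ⟨hc₀', -⟩ := z2_z2_z2m_quot_noncyclic (m := m)
    refine c2_quaternion_presentation (m := m) fun ρ τ c₀ hρρ hρτ hτρ hττ hρ hτ hne hsurj hc => ?_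
    subst hc
    refine c2_product_presentation hρρ hρτ hτρ hττ hρ hτ hne hsurj
      fun ρ' τ' c₀' hρρ' hρτ' hτρ' hττ' hρ' hτ' hne' hsurj' hc' => ?_
    subst hc'
    have hcard : Fintype.card (ZMod 2 × (ZMod 2 × ZMod (2 * m))) = 8 * m := by
      rw [Fintype.card_prod, Fintype.card_prod, ZMod.card, ZMod.card]; ring
    have key := tpp_volume_le_law_dicyclicLike hρρ' hρτ' hτρ' hττ' hρ' hτ' hne' hsurj'
      (two_c0_eq_zero hρτ' hτρ' hττ' hτ') hc₀' (by rw [hcard]; omega) (by rw [hcard]; omega) h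
    rw [hcard] at key
    omega
  · obtain ⟨S, T, U, h, hV⟩ := c2c2_quaternion_volume_ge (m := m) (by omega)
    refine ⟨S, T, U, h, ?_⟩
    rw [if_neg (by omega)] at hV
    omega

end C2C2Q

end Summit.MatrixMultiplication.OmegaCensus
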